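import Mathlib
import Summits.Ventures.PercRepro2.HalfLA2OPoly

/-!
# The Bernstein certificates of `HalfLA2O.lhs` (blind cell PercRepro2, night-1 g37)

`C_{k₁k₂}` is `6 ·` the `(k₁, k₂)` coefficient of the `(3,2)`-Bernstein expansion of `lhs` in `(r₁, r₂)`, an explicit
nonnegative integer combination of `cell × block` and cubic cell monomials (exact simplex, `deg2_rootmark.py`);
**`lhs_bern`** is the Bernstein identity (pure `ring`).
-/

namespace Summit.Ventures.PercRepro2

namespace HalfLA2O

section Certs

variable {R : Type*} [CommRing R]

/-- `6 · c_{00}` (10 terms). -/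
def C00 (c : Cells10 R) : R :=
  (6 : R) * (c.LL * blkHHN c) + (6 : R) * (c.LH * blkHHN c) + (6 : R) * (c.LN * blkHHN c) +
    (6 : R) * (c.HL * blkHHN c) + (6 : R) * (c.HH * blkHHN c) + (6 : R) * (c.HN * blkHHN c) +
    (6 : R) * (c.NL * blkHHN c) + (6 : R) * (c.NH * blkHHN c) + (6 : R) * (c.NNs * blkHHN c) +
    (6 : R) * (c.NNd * blkHHN c)

/-- `6 · c_{01}` (10 terms). -/
def C01 (c : Cells10 R) : R :=
  (3 : R) * (c.LL * blkHHN c) + (3 : R) * (c.LH * blkHHN c) + (3 : R) * (c.LN * blkHHN c) +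
    (3 : R) * (c.HL * blkHHN c) + (3 : R) * (c.HH * blkHHN c) + (3 : R) * (c.HN * blkHHN c) +
    (3 : R) * (c.NL * blkHHN c) + (3 : R) * (c.NH * blkHHN c) + (3 : R) * (c.NNs * blkHHN c) +
    (3 : R) * (c.NNd * blkHHN c)

/-- `6 · c_{10}` (20 terms). -/
def C10 (c : Cells10 R) : R :=
  (2 : R) * (c.LL * blkLL c) + (2 : R) * (c.LH * blkLL c) + (2 : R) * (c.LN * blkLL c) +
    (2 : R) * (c.HL * blkLL c) + (2 : R) * (c.HH * blkLL c) + (2 : R) * (c.HN * blkLL c) +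
    (2 : R) * (c.NL * blkLL c) + (2 : R) * (c.NH * blkLL c) + (2 : R) * (c.NNs * blkLL c) +
    (2 : R) * (c.NNd * blkLL c) + (2 : R) * (c.LL * blkHHN c) + (2 : R) * (c.LH * blkHHN c) +
    (2 : R) * (c.LN * blkHHN c) + (2 : R) * (c.HL * blkHHN c) + (2 : R) * (c.HH * blkHHN c) +
    (2 : R) * (c.HN * blkHHN c) + (2 : R) * (c.NL * blkHHN c) + (2 : R) * (c.NH * blkHHN c) +
    (2 : R) * (c.NNs * blkHHN c) + (2 : R) * (c.NNd * blkHHN c)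

/-- `6 · c_{11}` (14 terms). -/
def C11 (c : Cells10 R) : R :=
  (c.LL * blkLL c) + (c.LH * blkLL c) + (c.LN * blkLL c) + (c.NL * blkLL c) + (c.NH * blkLL c) +
    (c.NNs * blkLL c) + (c.NNd * blkLL c) + (c.HL * blkHHN c) + (c.HH * blkHHN c) +
    (c.HN * blkHHN c) + (c.NL * blkHHN c) + (c.NH * blkHHN c) + (c.NNs * blkHHN c) +
    (c.NNd * blkHHN c)

/-- `6 · c_{20}` (10 terms). -/
def C20 (c : Cells10 R) : R :=
  (2 : R) * (c.LL * blkLL c) + (2 : R) * (c.LH * blkLL c) + (2 : R) * (c.LN * blkLL c) +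
    (2 : R) * (c.HL * blkLL c) + (2 : R) * (c.HH * blkLL c) + (2 : R) * (c.HN * blkLL c) +
    (2 : R) * (c.NL * blkLL c) + (2 : R) * (c.NH * blkLL c) + (2 : R) * (c.NNs * blkLL c) +
    (2 : R) * (c.NNd * blkLL c)

/-- `6 · c_{21}` (4 terms). -/
def C21 (c : Cells10 R) : R :=
  (c.NL * blkLL c) + (c.NH * blkLL c) + (c.NNs * blkLL c) + (c.NNd * blkLL c)

/-- **The certified Bernstein form** of `6 · lhs`. -/
theorem lhs_bern (r₁ r₂ : R) (c : Cells10 R) :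
    6 * lhs r₁ r₂ c =
      (1 - r₁) ^ 3 * (1 - r₂) ^ 2 * C00 c +
      (2 : R) * (1 - r₁) ^ 3 * r₂ * (1 - r₂) * C01 c +
      (3 : R) * r₁ * (1 - r₁) ^ 2 * (1 - r₂) ^ 2 * C10 c +
      (6 : R) * r₁ * (1 - r₁) ^ 2 * r₂ * (1 - r₂) * C11 c +
      (3 : R) * r₁ ^ 2 * (1 - r₁) * (1 - r₂) ^ 2 * C20 c +
      (6 : R) * r₁ ^ 2 * (1 - r₁) * r₂ * (1 - r₂) * C21 c := by
  unfold lhs mQ mbL mT mTbL mTbLoU moH mbLoH mToU mPD mPDoU C00 C01 C10 C11 C20 C21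
    blkLL blkHHN
  ring

end Certs

end HalfLA2O

end Summit.Ventures.PercRepro2
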